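import Summits.CriticalPhenomena.PercolationContinuityZ3.Theorems.PercNearOneGluingNoHeavyQuantGammaOfOneArm
import Literature.Probability.Percolation.HutchcroftGammaLeDeltaSubOneHolds
import HarnessLib

/-!
# PAPER-2 track, ARM-3 gen 4: the converse after Question q:chi is now UNCONDITIONAL in the kernel
# (`(T1)` with exponent `c > d/4` ⇒ the subcritical susceptibility input `γ' < 2` of route (C))

builds on p205010 (kernel theorem, internal audit signed; external expert review pending).
Status sentence for p205010: "θ(p_c) = 0 on ℤ^d, all d ≥ 2 — kernel-verified (Lean 4/Mathlib, standard
axioms); internal adversarial audit SIGNED 2026-08-20 04:29Z; external expert review pending."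

Gen 3 (`…QuantGammaOfOneArm.lean`, p247366) proved, MODULO the named published fact
`Literature.Probability.Percolation.Hutchcroft2020_gamma_le_delta_sub_one` (Hutchcroft, Probab. Math. Phys. 1 (2020),
Thm 1.1 second bullet at `k = 1`), that a critical one-arm power law `OneArmPolyDecayAtCritical d c C` with `c > d/4`
gives the subcritical susceptibility input `SubcriticalGammaLtTwo d` of route (C) (with `g = d/c − 2`), and the lossy loop back
to `OneArmPolyDecayAtCritical d (2 − d/(2c)) C'`.  Gen 4 PROVED that fact in the kernel
(`Literature.Probability.Percolation.Hutchcroft2020_gamma_le_delta_sub_one_holds`, file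
`Literature/Probability/Percolation/HutchcroftGammaLeDeltaSubOneHolds.lean`, through Hutchcroft's volume differential inequality
(1.3) via the two-function OSSS inequality on biased product spaces and the ghost-field exploration).  This file records the three
implications WITHOUT the fact hypothesis; their only remaining hypothesis is (T1) itself (open for `3 ≤ d ≤ 10`).  Helper of item
stmt-CriticalPhenomena-4575 (`--supports`); nothing here is an input of p205010.
-/

noncomputable section

open MeasureTheory Literature.Probability.Percolation Literature.Probability.LatticeModels

namespace Summit.CriticalPhenomena.PercolationContinuityZ3.Theorems.Quant

variable {d : ℕ}

/-- **(T1) with `c > d/4` ⇒ a subcritical susceptibility power bound with `g = d/c − 2 < 2` — UNCONDITIONAL** (Hutchcroft's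
`γ ≤ δ − 1` is now a kernel theorem): `OneArmPolyDecayAtCritical d c C`, `d ≥ 2`, `d/4 < c` ⟹ `∃ M, ChiSubcritPowerBound d M (d/c − 2) 1`.
[cite: Hutchcroft2020, Thm. 1.1] -/
theorem chiSubcritPowerBound_of_oneArmPolyDecay_holds (hd : 2 ≤ d) {c C : ℝ} (hc : (d : ℝ) / 4 < c)
    (h : OneArmPolyDecayAtCritical d c C) : ∃ M : ℝ, ChiSubcritPowerBound d M ((d : ℝ) / c - 2) 1 :=
  chiSubcritPowerBound_of_oneArmPolyDecay Hutchcroft2020_gamma_le_delta_sub_one_holds hd hc h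

/-- **The converse after Question q:chi, UNCONDITIONAL in the kernel**: a critical one-arm power law with exponent `c > d/4`
(`d ≥ 2`) implies route (C)'s input `SubcriticalGammaLtTwo d` (`γ' = d/c − 2 < 2`).  The only hypothesis left is (T1) itself.
[cite: Hutchcroft2020, Thm. 1.1] [cite: DewanMuirhead2022, Thm. 1.1] -/
theorem subcriticalGammaLtTwo_of_oneArmPolyDecay_holds (hd : 2 ≤ d) {c C : ℝ} (hc : (d : ℝ) / 4 < c)
    (h : OneArmPolyDecayAtCritical d c C) : SubcriticalGammaLtTwo d :=
  subcriticalGammaLtTwo_of_oneArmPolyDecay Hutchcroft2020_gamma_le_delta_sub_one_holds hd hc h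

/-- **The lossy loop through route (C), UNCONDITIONAL**: `OneArmPolyDecayAtCritical d c C` with `c > d/4` gives back
`∃ C', OneArmPolyDecayAtCritical d (2 − d/(2c)) C'` (strictly weaker; no bootstrap).  Kernel end to end: two-box hyperscaling
(gen 3) ∘ Hutchcroft 2020 Thm 1.1 (gen 4, proved) ∘ Hutchcroft 2022 Thm 1.3 / route (C) (gen 1).
[cite: Hutchcroft2020, Thm. 1.1] [cite: Hutchcroft2022Triangle, Thm. 1.3] -/
theorem oneArmPolyDecayAtCritical_loop_holds (hd : 2 ≤ d) {c C : ℝ} (hc : (d : ℝ) / 4 < c)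
    (h : OneArmPolyDecayAtCritical d c C) : ∃ C' : ℝ, OneArmPolyDecayAtCritical d (2 - (d : ℝ) / (2 * c)) C' :=
  oneArmPolyDecayAtCritical_loop Hutchcroft2020_gamma_le_delta_sub_one_holds hd hc h

end Summit.CriticalPhenomena.PercolationContinuityZ3.Theorems.Quant

end
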